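import Summits.Ventures.CertifiedArithmetic.LowPrec.GemmFirstRegimeE2M1
import HarnessLib

/-!
# GEMM worst case LXI-b — the FIRST-REGIME LAW `W_p(n₀+k) = ku/(1+ku)` for E2M1² into every
# precision `p ≢ 1, 2 (mod 6)`, the two families of every precision, bfloat16 and binary32

HONEST FRAMING: certified error envelopes and provably optimal rounding/accumulation schemes for
low-precision formats under stated cost models; every table by two implementations; no hardware or
vendor claims.

Continues file LXI-a (`GemmFirstRegimeE2M1`: notation `W_φ`, `T = 2^(manBits+1)`, `j₀`, `n₀`; the exact
range `W_φ(n) = 0`, `n ≤ n₀`, and the restart bound `W_φ(n₀+k) ≤ k/(T+k)`, `k ≤ 2^{p-1}`).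

* `ew`, `ew_seqSum`, `relErr_entryWord` — ENTRY WORDS `A/4, B/4, 36^{×j₀}, ¼, ¼, …` with
  `V = A + B + 144 j₀ ∈ {V₀, V₀+1}`, `T ≤ V₀ < 2T`, `4 ∣ V₀`: the prefix is exact (file LXI-a), the sum
  `V₀/4` has an even significand on the binade of spacing `½`, so `fl((V₀+1)/4) = V₀/4`
  (`roundNE_tie_down`, one application of the binade step of file XLIX-a) and every later `¼` is a
  dropped tie: relative error exactly `(V + d - V₀)/(V + d)` after `j₀ + 2 + d` letters.
* `le_worstP_firstRegime`, `worstP_firstRegime` — THE LAW: if `T + 1 = A + B + 144 j₀` over letters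
  `A/4, B/4` — true iff `p ≡ 0, 3, 4, 5 (mod 6)`, with `(A,B) = (64,1), (72,9), (16,1), (32,1)`, i.e.
  the letters `(16,¼), (18,9/4), (4,¼), (8,¼)`, since `T mod 144 = 64, 80, 16, 32` there — then
  `k/(T+k) ≤ W_φ(j₀+k)` for EVERY `k ≥ 1`, hence `W_φ(n₀+k) = k/(T+k) = ku/(1+ku)` for
  `1 ≤ k ≤ 2^{p-1}`: Lange–Rump's bound for `k` additions of values of `F_φ` is the exact worst case
  of `n₀ + k` FP4 products [BoldoEtAl2023, Thm 4.5: attained by `(1,u,…,u)`; here by letters].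
* `le_worstP_plateau`, `worstP_pos`, `le_worstP_lateEntry` — EVERY PRECISION: the plateau family
  `36^{×n₀} ¼^{×k}` gives `k/(144n₀+k) ≤ W_φ(n₀+k)` (so the zero range is exactly `n ≤ n₀`), and
  `C/4, D/4, 36^{×j₀}, ¼^{×k}` with `C + D + 144j₀ = T` gives `k/(T+k) ≤ W_φ(n₀+1+k)`; for
  `p ≡ 1, 2 (mod 6)` (`T mod 144 = 128, 112`: `T+1` is not a sum of `n₀+1` letters in quarter units)
  `max(k/(144n₀+k), (k-1)/(T+k-1)) ≤ W_φ(n₀+k) ≤ k/(T+k)`; equality on the left is the certified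
  bfloat16 law of gemm.tex Prop. p:bf16law (`p = 8`, `n ≤ 131`) and is conjectured for `p = 13, 14, 19, …`
  (implementation C2, `code/gemm/firstregime/`, confirms it for `p = 13` (`k ≤ 11`) and `p = 14` (`k ≤ 10`)).
* `worstP_BFloat16_firstRegime` — bfloat16 (`p = 8 ≡ 2`, `n₀ = 2`, `(C,D) = (64,48)`):
  `max(k/(288+k), (k-1)/(255+k)) ≤ W_8(2+k) ≤ k/(256+k)`, `1 ≤ k ≤ 128`, by the all-precision
  theorems (the kernel certificate `worstRelErrE2M1BF16` of file XLVI gives equality on the left).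
* `worstP_Binary32_eq_zero`, `worstP_Binary32_firstRegime`, `worstP_Binary32_first` — binary32
  (`p = 24 ≡ 0`, `2^24 = 144·116508 + 64`, `n₀ = 116509`, letters `(16, ¼)`): `W_24(n) = 0` iff
  `n ≤ 116509`, and `W_24(n) = (n - 116509)/(2^24 + n - 116509)` for `116510 ≤ n ≤ 8505117`
  (gemm.tex Prop. p:fpP; Lemma l:Z's `116508` is `n₀ - 1`).

Method: as file LXI-a — the precision is a symbol; the only rounding facts are `roundNE_quarter_nat`
and `rneSigMag_binade_step` of file XLIX-a at the single tie `V₀ + 1 ↦ V₀`.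
References: [BoldoEtAl2023, Thm 4.5], [LangeRump2019]; [IEEE7542019, §4.3.1] (ties to even);
[Higham2002, §4.2]; [RouhaniEtAl2023MX, Table 1]; [BlanchardHighamLopezMaryPranesh2020, Table 1.1]
(bfloat16); FRESHNESS-GEMM.md gen 15 (novelty presearch).
-/

namespace Summit.Ventures.CertifiedArithmetic.LowPrec.Gemm

open Literature.ComputerArithmetic.FloatingPoint
open Literature.ComputerArithmetic.FloatingPoint.MiniFloat
open Finset

variable {φ : Format}

section Regime

/-! ### Entry words `A/4, B/4, 36^{×j₀}, ¼, ¼, …` and the single tie `V₀ + 1 ↦ V₀` -/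

/-- The entry word in quarter units: `A, B, 144^{×j₀}, 1, 1, …`. [cell, gemm.tex Prop. p:fpP (iii)] -/
def ewN (j0 A B : ℕ) (i : ℕ) : ℕ :=
  if i = 0 then A else if i = 1 then B else if i ≤ j0 + 1 then 144 else 1

/-- The entry word in value units. [cell] -/
def ew (j0 A B : ℕ) : ℕ → ℚ := fun i => (ewN j0 A B i : ℚ) / 4

/-- Its letters are letters of `Π(E2M1,E2M1)` when `A/4`, `B/4` are. [cell] -/
theorem ew_mem {j0 A B : ℕ} (hA : ((A : ℕ) : ℚ) / 4 ∈ piE2M1) (hB : ((B : ℕ) : ℚ) / 4 ∈ piE2M1)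
    (i : ℕ) : ew j0 A B i ∈ piE2M1 := by
  unfold ew ewN
  split_ifs
  · exact hA
  · exact hB
  · norm_num [piE2M1]
  · norm_num [piE2M1]

/-- Letter `0` is `A`. [cell] -/
theorem ewN_zero (j0 A B : ℕ) : ewN j0 A B 0 = A := by unfold ewN; rw [if_pos rfl]

/-- Letter `1` is `B`. [cell] -/
theorem ewN_one (j0 A B : ℕ) : ewN j0 A B 1 = B := by
  unfold ewN; rw [if_neg one_ne_zero, if_pos rfl]

/-- Letters `2 … j₀+1` are `144`. [cell] -/
theorem ewN_mid {j0 A B i : ℕ} (h2 : 2 ≤ i) (h : i ≤ j0 + 1) : ewN j0 A B i = 144 := by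
  unfold ewN; rw [if_neg (by omega), if_neg (by omega), if_pos h]

/-- Letters after `j₀+1` are `1`. [cell] -/
theorem ewN_tail {j0 A B i : ℕ} (h : j0 + 1 < i) : ewN j0 A B i = 1 := by
  unfold ewN; rw [if_neg (by omega), if_neg (by omega), if_neg (by omega)]

/-- Mass of the entry word: `Σ_{i ≤ j₀+1+d} ewN i = A + B + 144 j₀ + d`. [cell] -/
theorem ewN_mass (j0 A B : ℕ) : ∀ d : ℕ,
    ∑ i ∈ range (j0 + 1 + d + 1), ewN j0 A B i = A + B + 144 * j0 + d
  | 0 => by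
      have h : ∑ i ∈ range j0, ewN j0 A B (i + 1 + 1) = ∑ _i ∈ range j0, 144 :=
        sum_congr rfl fun i hi => ewN_mid (by omega) (by have := mem_range.mp hi; omega)
      rw [show j0 + 1 + 0 + 1 = j0 + 1 + 1 by ring, sum_range_succ', sum_range_succ', ewN_zero,
        zero_add, ewN_one, h, sum_const, card_range, smul_eq_mul]
      ring
  | d + 1 => by
      rw [show j0 + 1 + (d + 1) + 1 = (j0 + 1 + d + 1) + 1 by ring, sum_range_succ,
        ewN_mass j0 A B d, ewN_tail (by omega)]
      ring

/-- … in value units. [cell] -/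
theorem ew_mass (j0 A B d : ℕ) :
    ∑ i ∈ range (j0 + 1 + d + 1), ew j0 A B i = ((A + B + 144 * j0 + d : ℕ) : ℚ) / 4 := by
  unfold ew
  simp only [div_eq_mul_inv]
  rw [← Finset.sum_mul, ← Nat.cast_sum, ewN_mass]

/-- … and the mass of moduli is the same (all letters are nonnegative). [cell] -/
theorem ew_absMass (j0 A B d : ℕ) :
    ∑ i ∈ range (j0 + 1 + d + 1), |ew j0 A B i| = ((A + B + 144 * j0 + d : ℕ) : ℚ) / 4 := by
  rw [← ew_mass]
  exact sum_congr rfl fun i _ => abs_of_nonneg (by unfold ew; positivity)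

variable (hm : 7 ≤ φ.manBits) (hq : φ.qexp ≤ -2) (hR : (2 : ℚ) ^ (φ.manBits + 10) ≤ φ.maxRat)
include hm hq hR

/-- THE TIE, every precision: for `T ≤ V₀ < 2T` with `4 ∣ V₀` (an even significand on the binade of
spacing `½`), `fl_φ((V₀+1)/4) = V₀/4` — the quarter above is a midpoint and ties-to-even drops it.
[cite: IEEE7542019, §4.3.1; via `rneSigMag_binade_step`] -/
theorem roundNE_tie_down {V0 : ℕ} (hT : 2 ^ (φ.manBits + 1) ≤ V0) (h2 : V0 < 2 ^ (φ.manBits + 2))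
    (h4 : 4 ∣ V0) : (roundNE φ (((V0 + 1 : ℕ) : ℚ) / 4)).toRat = (V0 : ℚ) / 4 := by
  obtain ⟨c, hc⟩ := h4
  have hM1 : 2 ^ (φ.manBits + 1) = 2 * 2 ^ φ.manBits := by ring
  have hM2 : 2 ^ (φ.manBits + 2) = 4 * 2 ^ φ.manBits := by ring
  obtain ⟨e, he⟩ : ∃ e, 2 ^ φ.manBits = 2 * e :=
    ⟨2 ^ (φ.manBits - 1), by rw [← pow_succ', Nat.sub_add_cancel (by omega : 1 ≤ φ.manBits)]⟩
  have hlt : V0 + 1 < 2 ^ (φ.manBits + 10 + 2) := by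
    have : 2 ^ (φ.manBits + 2) < 2 ^ (φ.manBits + 10 + 2) := Nat.pow_lt_pow_right (by norm_num) (by omega)
    omega
  rw [roundNE_quarter_nat hq hR hlt]
  have ht : 2 * c - 2 ^ φ.manBits < 2 ^ φ.manBits := by omega
  have key := rneSigMag_binade_step (m := φ.manBits) (j := 0) (r := 1) (u := 2) rfl ⟨e, he⟩
    (by norm_num) ht (by norm_num)
  have e1 : (2 ^ φ.manBits + (2 * c - 2 ^ φ.manBits)) * 2 + 1 = V0 + 1 := by omega
  have e2 : stepUp (2 * c - 2 ^ φ.manBits) 1 2 = 0 := by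
    unfold stepUp; rw [if_neg (by norm_num), if_neg (by norm_num)]
    omega
  rw [e1, e2] at key
  rw [key]
  congr 1
  have : (2 ^ φ.manBits + (2 * c - 2 ^ φ.manBits) + 0) * 2 = V0 := by omega
  exact_mod_cast this

/-- TRAJECTORY OF AN ENTRY WORD: if `V = A + B + 144 j₀ ∈ {V₀, V₀+1}` with `T ≤ V₀ < 2T`, `4 ∣ V₀`
and `144 j₀ < T`, then after letter `j₀ + 1` and ever after the accumulator holds `V₀/4`.
[cell, gemm.tex Prop. p:fpP (iii)] -/
theorem ew_seqSum {j0 A B V0 : ℕ} (hA : ((A : ℕ) : ℚ) / 4 ∈ piE2M1)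
    (hB : ((B : ℕ) : ℚ) / 4 ∈ piE2M1) (hj0 : 144 * j0 < 2 ^ (φ.manBits + 1))
    (hT : 2 ^ (φ.manBits + 1) ≤ V0) (h2 : V0 < 2 ^ (φ.manBits + 2)) (h4 : 4 ∣ V0)
    (hV : A + B + 144 * j0 = V0 ∨ A + B + 144 * j0 = V0 + 1) :
    ∀ d, (seqSum φ (ew j0 A B) (j0 + 1 + d)).toRat = (V0 : ℚ) / 4
  | 0 => by
      have hm0 := ew_mass j0 A B 0
      simp only [Nat.add_zero] at hm0
      rw [Nat.add_zero]
      simp only [seqSum]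
      rw [seqSum_exact_prefix hm hq hR (ew_mem hA hB) hj0 j0 le_rfl, ← sum_range_succ, hm0]
      rcases hV with hV | hV
      · rw [hV]
        have hrep := quarter_repr hq hR (K := (V0 : ℤ)) (Or.inr ⟨by omega, by omega⟩)
        push_cast at hrep
        exact toRat_roundNE_of_exists hrep
      · rw [hV]; exact roundNE_tie_down hm hq hR hT h2 h4
  | d + 1 => by
      rw [show j0 + 1 + (d + 1) = (j0 + 1 + d) + 1 by ring]
      simp only [seqSum]
      rw [ew_seqSum hA hB hj0 hT h2 h4 hV d]
      have hlet : ew j0 A B (j0 + 1 + d + 1) = 1 / 4 := by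
        unfold ew; rw [ewN_tail (by omega)]; push_cast; ring
      rw [hlet, show (V0 : ℚ) / 4 + 1 / 4 = ((V0 + 1 : ℕ) : ℚ) / 4 by push_cast; ring]
      exact roundNE_tie_down hm hq hR hT h2 h4

/-- RELATIVE ERROR OF AN ENTRY WORD after `j₀ + 2 + d` letters: `(V + d - V₀)/(V + d)` exactly.
[cell, gemm.tex Prop. p:fpP (iii)] -/
theorem relErr_entryWord {j0 A B V0 : ℕ} (hA : ((A : ℕ) : ℚ) / 4 ∈ piE2M1)
    (hB : ((B : ℕ) : ℚ) / 4 ∈ piE2M1) (hj0 : 144 * j0 < 2 ^ (φ.manBits + 1))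
    (hT : 2 ^ (φ.manBits + 1) ≤ V0) (h2 : V0 < 2 ^ (φ.manBits + 2)) (h4 : 4 ∣ V0)
    (hV : A + B + 144 * j0 = V0 ∨ A + B + 144 * j0 = V0 + 1) (d : ℕ) :
    relErr φ (ew j0 A B) (j0 + 1 + d)
      = (((A + B + 144 * j0 + d : ℕ) : ℚ) - V0) / ((A + B + 144 * j0 + d : ℕ) : ℚ) := by
  unfold relErr
  rw [ew_seqSum hm hq hR hA hB hj0 hT h2 h4 hV d, ew_mass, ew_absMass]
  have hle : (V0 : ℚ) ≤ ((A + B + 144 * j0 + d : ℕ) : ℚ) := by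
    exact_mod_cast (by omega : V0 ≤ A + B + 144 * j0 + d)
  have hpos : (0 : ℚ) < ((A + B + 144 * j0 + d : ℕ) : ℚ) := by
    have : 0 < V0 := lt_of_lt_of_le (by positivity) hT
    exact_mod_cast (by omega : 0 < A + B + 144 * j0 + d)
  rw [abs_sub_comm, abs_of_nonneg (by linarith), div_sub_div_same,
    div_div_div_cancel_right₀ (by norm_num : (4 : ℚ) ≠ 0)]

/-! ### Attainment and the exact law for `p ≡ 0, 3, 4, 5 (mod 6)` -/

/-- ATTAINMENT, every precision with `T + 1 = A + B + 144 j₀` over letters `A/4, B/4`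
(`p ≡ 0,3,4,5 (mod 6)`): `k/(T+k) ≤ W_φ(n₀+k)` for EVERY `k ≥ 1` — the word `A/4, B/4, 36^{×j₀}, ¼…`.
[cell, gemm.tex Prop. p:fpP (iii)] -/
theorem le_worstP_firstRegime {j0 A B : ℕ} (hA : ((A : ℕ) : ℚ) / 4 ∈ piE2M1)
    (hB : ((B : ℕ) : ℚ) / 4 ∈ piE2M1) (hj0 : 144 * j0 < 2 ^ (φ.manBits + 1))
    (hAB : A + B + 144 * j0 = 2 ^ (φ.manBits + 1) + 1) {k : ℕ} (hk : 1 ≤ k) :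
    (k : ℚ) / (2 ^ (φ.manBits + 1) + k) ≤ worstRelErrE2M1 φ (j0 + k) := by
  obtain ⟨d, rfl⟩ : ∃ d, k = d + 1 := ⟨k - 1, by omega⟩
  have hT2 : 2 ^ (φ.manBits + 2) = 2 * 2 ^ (φ.manBits + 1) := by ring
  have h4 : 4 ∣ 2 ^ (φ.manBits + 1) := ⟨2 ^ (φ.manBits - 1), by
    rw [show (4 : ℕ) = 2 ^ 2 by norm_num, ← pow_add]; congr 1; omega⟩
  have h := relErr_entryWord hm hq hR hA hB hj0 le_rfl (by omega) h4 (Or.inr hAB) d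
  rw [show j0 + (d + 1) = j0 + 1 + d by ring]
  calc _ = relErr φ (ew j0 A B) (j0 + 1 + d) := by rw [h, hAB]; push_cast; ring
    _ ≤ _ := relErr_le_worstP φ _ (ew_mem hA hB) _

/-- THE EXACT FIRST-REGIME LAW for `p ≡ 0, 3, 4, 5 (mod 6)` (`T + 1 = A + B + 144 j₀` over letters):
`W_φ(n₀ + k) = k/(T + k) = ku/(1+ku)` for every `1 ≤ k ≤ 2^{p-1}`. [cell, gemm.tex Prop. p:fpP (iii)] -/
theorem worstP_firstRegime {j0 A B : ℕ} (hA : ((A : ℕ) : ℚ) / 4 ∈ piE2M1)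
    (hB : ((B : ℕ) : ℚ) / 4 ∈ piE2M1) (hj0 : 144 * j0 < 2 ^ (φ.manBits + 1))
    (hAB : A + B + 144 * j0 = 2 ^ (φ.manBits + 1) + 1) {k : ℕ} (hk : 1 ≤ k)
    (hk' : k ≤ 2 ^ φ.manBits) :
    worstRelErrE2M1 φ (j0 + k) = (k : ℚ) / (2 ^ (φ.manBits + 1) + k) :=
  le_antisymm (worstP_le_firstRegime hm hq hR hj0 hk') (le_worstP_firstRegime hm hq hR hA hB hj0 hAB hk)

omit hm hq hR in
/-- The law in Lange–Rump's form: `k/(T+k) = ku/(1+ku)`, `u = 2^{-p}`. [cite: BoldoEtAl2023, Thm 4.5] -/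
theorem firstRegime_eq_langeRump (k : ℕ) :
    (k : ℚ) / (2 ^ (φ.manBits + 1) + k) = k * φ.unitRoundoff / (1 + k * φ.unitRoundoff) := by
  rw [Format.unitRoundoff_eq]; field_simp

/-! ### The two families available in every precision; sharpness of the zero range -/

/-- THE PLATEAU FAMILY `36^{×n₀} ¼^{×k}`, every precision: with `144 j₀ < T ≤ 144(j₀+1) = 144 n₀`,
`k/(144 n₀ + k) ≤ W_φ(j₀ + k)` (`36 n₀ ∈ [2^{p-2}, 2^{p-1})` has an even significand; every `¼` is a
dropped tie). [cell, gemm.tex Prop. p:fpP (iv)] -/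
theorem le_worstP_plateau {j0 : ℕ} (hj0 : 144 * j0 < 2 ^ (φ.manBits + 1))
    (hj0' : 2 ^ (φ.manBits + 1) ≤ 144 * (j0 + 1)) (k : ℕ) :
    (k : ℚ) / (144 * (j0 + 1) + k) ≤ worstRelErrE2M1 φ (j0 + k) := by
  have h36 : ((144 : ℕ) : ℚ) / 4 ∈ piE2M1 := by norm_num [piE2M1]
  have h256 : 256 ≤ 2 ^ (φ.manBits + 1) :=
    le_trans (by norm_num) (Nat.pow_le_pow_right (by norm_num) (by omega : 8 ≤ φ.manBits + 1))
  obtain ⟨j, rfl⟩ : ∃ j, j0 = j + 1 := ⟨j0 - 1, by omega⟩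
  have hT2 : 2 ^ (φ.manBits + 2) = 2 * 2 ^ (φ.manBits + 1) := by ring
  have h := relErr_entryWord hm hq hR h36 h36 (j0 := j) (V0 := 144 * (j + 1 + 1)) (by omega)
    hj0' (by omega) ⟨36 * (j + 1 + 1), by ring⟩ (Or.inl (by ring)) k
  calc _ = relErr φ (ew j 144 144) (j + 1 + k) := by rw [h]; push_cast; ring
    _ ≤ _ := relErr_le_worstP φ _ (ew_mem h36 h36) _

/-- SHARPNESS OF THE ZERO RANGE, every precision: `W_φ(n₀ + 1) > 0`. [cell, gemm.tex Prop. p:fpP (i)] -/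
theorem worstP_pos {j0 : ℕ} (hj0 : 144 * j0 < 2 ^ (φ.manBits + 1))
    (hj0' : 2 ^ (φ.manBits + 1) ≤ 144 * (j0 + 1)) : 0 < worstRelErrE2M1 φ (j0 + 1) := by
  have h := le_worstP_plateau hm hq hR hj0 hj0' 1
  push_cast at h
  exact lt_of_lt_of_le (by positivity) h

/-- THE LATE-ENTRY FAMILY `C/4, D/4, 36^{×j₀}, ¼^{×k}` with `C + D + 144 j₀ = T`, every precision:
`k/(T + k) ≤ W_φ(j₀ + 1 + k)` (one letter later than the law of `worstP_firstRegime`; for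
`p ≡ 1, 2 (mod 6)` take `(C,D) = (64,64)` resp. `(64,48)`). [cell, gemm.tex Prop. p:fpP (iv)] -/
theorem le_worstP_lateEntry {j0 C D : ℕ} (hC : ((C : ℕ) : ℚ) / 4 ∈ piE2M1)
    (hD : ((D : ℕ) : ℚ) / 4 ∈ piE2M1) (hj0 : 144 * j0 < 2 ^ (φ.manBits + 1))
    (hCD : C + D + 144 * j0 = 2 ^ (φ.manBits + 1)) (k : ℕ) :
    (k : ℚ) / (2 ^ (φ.manBits + 1) + k) ≤ worstRelErrE2M1 φ (j0 + 1 + k) := by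
  have hT2 : 2 ^ (φ.manBits + 2) = 2 * 2 ^ (φ.manBits + 1) := by ring
  have h4 : 4 ∣ 2 ^ (φ.manBits + 1) := ⟨2 ^ (φ.manBits - 1), by
    rw [show (4 : ℕ) = 2 ^ 2 by norm_num, ← pow_add]; congr 1; omega⟩
  have h := relErr_entryWord hm hq hR hC hD hj0 le_rfl (by omega) h4 (Or.inl hCD) k
  calc _ = relErr φ (ew j0 C D) (j0 + 1 + k) := by rw [h, hCD]; push_cast; ring
    _ ≤ _ := relErr_le_worstP φ _ (ew_mem hC hD) _

end Regime

/-! ### bfloat16 (`p = 8 ≡ 2 (mod 6)`): `T = 256 = 144 + 112`, `n₀ = 2`, `(C, D) = (64, 48)` -/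

/-- bfloat16 meets the hypotheses. [cite: BlanchardHighamLopezMaryPranesh2020, Table 1.1] -/
theorem BFloat16_first_hyps : 7 ≤ Format.BFloat16.manBits ∧ Format.BFloat16.qexp ≤ -2 ∧
    (2 : ℚ) ^ (Format.BFloat16.manBits + 10) ≤ Format.BFloat16.maxRat := by
  refine ⟨le_of_eq rfl, by decide, ?_⟩
  rw [Format.BFloat16_maxRat.1, show Format.BFloat16.manBits = 7 from rfl]
  norm_num

/-- FP4 PRODUCTS INTO bfloat16, `3 ≤ n ≤ 130`, FROM THE ALL-PRECISION THEOREMS: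
`max(k/(288+k), (k-1)/(255+k)) ≤ W_8(2+k) ≤ k/(256+k)` for `1 ≤ k ≤ 128` (index `m = 1 + k`); the
left side is the certified exact value (gemm.tex Prop. p:bf16law, `n = k + 2 ≤ 131`: the two
families `36,36,¼^{×k}` and `16,12,36,¼^{×(k-1)}`). [cell, gemm.tex Prop. p:fpP (iv)] -/
theorem worstP_BFloat16_firstRegime {k : ℕ} (hk : 1 ≤ k) (hk' : k ≤ 128) :
    max ((k : ℚ) / (288 + k)) (((k : ℚ) - 1) / (255 + k)) ≤ worstRelErrE2M1 Format.BFloat16 (1 + k) ∧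
      worstRelErrE2M1 Format.BFloat16 (1 + k) ≤ (k : ℚ) / (256 + k) := by
  obtain ⟨h1, h2, h3⟩ := BFloat16_first_hyps
  have hT : 2 ^ (Format.BFloat16.manBits + 1) = 256 := by decide
  have hk'' : k ≤ 2 ^ Format.BFloat16.manBits := hk'
  have hup := worstP_le_firstRegime h1 h2 h3 (j0 := 1) (by omega) hk''
  have hpl := le_worstP_plateau h1 h2 h3 (j0 := 1) (by omega) (by omega) k
  obtain ⟨d, rfl⟩ : ∃ d, k = d + 1 := ⟨k - 1, by omega⟩
  have hle := le_worstP_lateEntry h1 h2 h3 (j0 := 1) (C := 64) (D := 48) (by norm_num [piE2M1])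
    (by norm_num [piE2M1]) (by omega) (by omega) d
  rw [show Format.BFloat16.manBits + 1 = 8 from rfl] at hup hle
  rw [show 1 + 1 + d = 1 + (d + 1) by ring] at hle
  have e8 : (2 : ℚ) ^ 8 = 256 := by norm_num
  rw [e8] at hup hle
  push_cast at hup hpl hle ⊢
  refine ⟨max_le ?_ ?_, hup⟩
  · calc _ = ((d : ℚ) + 1) / (144 * (1 + 1) + ((d : ℚ) + 1)) := by norm_num
      _ ≤ _ := hpl
  · calc _ = (d : ℚ) / (256 + (d : ℚ)) := by ring
      _ ≤ _ := hle

/-! ### binary32 (`p = 24`): `T = 2^24 = 144·116508 + 64`, `n₀ = 116509`, letters `(16, ¼)` -/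

/-- `W_24(n) = 0` FOR EVERY `n ≤ 116509` (E2M1·E2M1 products, sequential binary32 accumulation,
RNE): the index `m = n - 1 ≤ 116508`. [cell, gemm.tex Prop. p:fpP / Lemma l:Z sharpened] -/
theorem worstP_Binary32_eq_zero {m : ℕ} (hm : m ≤ 116508) :
    worstRelErrE2M1 Format.Binary32 m = 0 := by
  obtain ⟨h1, h2, h3, h4⟩ := Binary32_hyps
  have hT : 2 ^ (Format.Binary32.manBits + 1) = 16777216 := by rw [pow_succ, h4]; norm_num
  exact worstP_eq_zero h1 h2 h3 (by omega)

/-- THE EXACT WORST CASE OF FP4 PRODUCTS ACCUMULATED IN binary32, `116510 ≤ n ≤ 8505117`: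
`W_24(116509 + k) = k/(2^24 + k)` for `1 ≤ k ≤ 2^23` (index `m = 116508 + k`), attained by
`16, ¼, 36^{×116508}, ¼^{×(k-1)}` (any order of the first `116510` letters). [cell, gemm.tex Prop. p:fpP] -/
theorem worstP_Binary32_firstRegime {k : ℕ} (hk : 1 ≤ k) (hk' : k ≤ 2 ^ 23) :
    worstRelErrE2M1 Format.Binary32 (116508 + k) = (k : ℚ) / (2 ^ 24 + k) := by
  obtain ⟨h1, h2, h3, h4⟩ := Binary32_hyps
  have hT : 2 ^ (Format.Binary32.manBits + 1) = 16777216 := by rw [pow_succ, h4]; norm_num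
  have hk'' : k ≤ 2 ^ Format.Binary32.manBits := hk'
  have h := worstP_firstRegime h1 h2 h3 (j0 := 116508) (A := 64) (B := 1) (by norm_num [piE2M1])
    (by norm_num [piE2M1]) (by omega) (by omega) hk hk''
  rw [h, show Format.Binary32.manBits + 1 = 24 from rfl]

/-- The first nonzero value: `W_24(116510) = 1/16777217 > 0`. [cell, gemm.tex Prop. p:fpP] -/
theorem worstP_Binary32_first : worstRelErrE2M1 Format.Binary32 116509 = 1 / 16777217 := by
  rw [show (116509 : ℕ) = 116508 + 1 from rfl, worstP_Binary32_firstRegime le_rfl (by norm_num)]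
  norm_num


end Summit.Ventures.CertifiedArithmetic.LowPrec.Gemm
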